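import Literature.Algebra.Lie.WhittakerFunctionalDescent
import Mathlib.RingTheory.Adjoin.Basic
import HarnessLib

/-!
# The `e⁻`-degree filtrations of Jacquet–Shalika's automatic-continuity argument: functionals and operators

Topic `Algebra/Lie`; namespace `Literature.Algebra.Lie.WhittakerDescent` (continuing
`WhittakerFunctionalDescent`). Pure algebra over a field `F`: `V` a vector space, `B ≤ End V` a
subalgebra ("`𝔍`", the image of `U(𝔟)` and the scalars), letters `e⁻ a ∈ End V` (`a` in a finite
index type) satisfying (H1) `e⁻ a · b ∈ B · e⁻ a + B` for `b ∈ B`. Two filtrations by `e⁻`-degree: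

* on functionals, `repSubmodule W e⁻ = {w + Σ_a μ_a ∘ e⁻ a | w, μ_a ∈ W}` (so that a family
  `W (J+1) = repSubmodule (W J) e⁻` is exactly the hypothesis `hWsucc` of
  `mem_zero_of_mem_of_covariant`), with `mem_repSubmodule_iff`;
* on operators, `mulRepSubmodule S e⁻ = {x + Σ_a y_a · e⁻ a | x, y_a ∈ S}` and the filtration
  `degFilt B e⁻ : ℕ → Submodule F (End V)`, `degFilt 0 = B`, `degFilt (J+1) = mulRepSubmodule (degFilt J) e⁻`.

Results (the "Poincaré–Birkhoff–Witt bookkeeping" `U(𝔤) = Σ_J U(𝔟) · 𝔲̄^J` in the form needed):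

* `degFilt_mono`, `mul_mem_degFilt_of_mem` (`degFilt J · B ⊆ degFilt J`, by (H1)),
  `mul_em_mem_degFilt_succ`, `mul_mem_degFilt_add` (**multiplicativity**
  `degFilt J · degFilt J' ⊆ degFilt (J + J')`), `exists_mem_degFilt_of_mem_adjoin` (**every element of the
  subalgebra generated by `B` and finitely many elements of finite degree has finite degree**);
* `comp_mem_of_mem_degFilt` — **link**: if `W 0` is right `B`-stable and
  `W (J+1) = repSubmodule (W J) e⁻`, then `μ ∘ x ∈ W J` for `μ ∈ W 0` and `x ∈ degFilt J`.

With `mem_zero_of_mem_of_covariant` this reduces Jacquet–Shalika's automatic continuity for `GL₂`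
(Jacquet–Shalika (1981), proof of Prop. (3.8), p. 523) to: the Sobolev words of the Whittaker
functional lie in the algebra generated by `B` and the `e⁻`-letters — on the route to the named fact
`Literature.NumberTheory.Automorphic.JacquetShalika1981_archKirillovNorm_le`.

## References

* H. Jacquet, J. A. Shalika, *On Euler products and the classification of automorphic
  representations I*, Amer. J. Math. 103 (1981), §3, Lemma (3.4) and the proof of Prop. (3.8),
  p. 523 [JacquetShalikaAJM1981].
-/

namespace Literature.Algebra.Lie.WhittakerDescent

open scoped BigOperators

variable {F : Type*} [Field F] {V : Type*} [AddCommGroup V] [Module F V]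

/-! ### 1. The degree-raising step on functionals -/

/-- **Functionals of the form `w + Σ_a μ_a ∘ e⁻ a` with `w, μ_a ∈ W`** (one more `e⁻`-derivative on
the right; Jacquet–Shalika's `𝔏(Ū)𝒲 + 𝒲`, p. 523), as a submodule of the dual.
[cite: JacquetShalikaAJM1981, §3, proof of Prop. (3.8), statement (2), p. 523] -/
def repSubmodule {ι : Type*} [Fintype ι] (W : Submodule F (V →ₗ[F] F)) (em : ι → Module.End F V) :
    Submodule F (V →ₗ[F] F) where
  carrier := {ν | ∃ w ∈ W, ∃ μ : ι → V →ₗ[F] F, (∀ a, μ a ∈ W) ∧ ν = w + ∑ a, (μ a).comp (em a)}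
  zero_mem' := ⟨0, W.zero_mem, 0, fun _ => W.zero_mem, by simp⟩
  add_mem' := by
    rintro ν ν' ⟨w, hw, μ, hμ, rfl⟩ ⟨w', hw', μ', hμ', rfl⟩
    refine ⟨w + w', W.add_mem hw hw', fun a => μ a + μ' a, fun a => W.add_mem (hμ a) (hμ' a), ?_⟩
    simp only [LinearMap.add_comp, Finset.sum_add_distrib]
    abel
  smul_mem' := by
    rintro c ν ⟨w, hw, μ, hμ, rfl⟩
    refine ⟨c • w, W.smul_mem c hw, fun a => c • μ a, fun a => W.smul_mem c (hμ a), ?_⟩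
    simp only [smul_add, Finset.smul_sum, LinearMap.smul_comp]

/-- Membership in `repSubmodule`. [folklore] -/
theorem mem_repSubmodule_iff {ι : Type*} [Fintype ι] (W : Submodule F (V →ₗ[F] F)) (em : ι → Module.End F V)
    (ν : V →ₗ[F] F) :
    ν ∈ repSubmodule W em ↔ ∃ w ∈ W, ∃ μ : ι → V →ₗ[F] F, (∀ a, μ a ∈ W) ∧ ν = w + ∑ a, (μ a).comp (em a) :=
  Iff.rfl

/-- `W ≤ repSubmodule W e⁻` (take `μ = 0`). [folklore] -/
theorem le_repSubmodule {ι : Type*} [Fintype ι] (W : Submodule F (V →ₗ[F] F)) (em : ι → Module.End F V) :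
    W ≤ repSubmodule W em := fun ν hν =>
  ⟨ν, hν, 0, fun _ => W.zero_mem, by simp⟩

/-- `μ ∘ e⁻ a ∈ repSubmodule W e⁻` for `μ ∈ W`. [folklore] -/
theorem comp_em_mem_repSubmodule {ι : Type*} [Fintype ι] [DecidableEq ι] (W : Submodule F (V →ₗ[F] F))
    (em : ι → Module.End F V) {μ : V →ₗ[F] F} (hμ : μ ∈ W) (a : ι) :
    μ.comp (em a) ∈ repSubmodule W em := by
  refine ⟨0, W.zero_mem, fun a' => if a' = a then μ else 0, fun a' => ?_, ?_⟩
  · show (if a' = a then μ else 0) ∈ W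
    by_cases h : a' = a
    · rw [if_pos h]; exact hμ
    · rw [if_neg h]; exact W.zero_mem
  · rw [zero_add]
    have : ∀ a', (if a' = a then μ else 0).comp (em a') = if a' = a then μ.comp (em a) else 0 := by
      intro a'
      by_cases h : a' = a
      · subst h; rw [if_pos rfl, if_pos rfl]
      · rw [if_neg h, if_neg h, LinearMap.zero_comp]
    simp_rw [this]
    rw [Finset.sum_ite_eq' Finset.univ a, if_pos (Finset.mem_univ _)]

/-! ### 2. The degree filtration on operators -/

/-- **Operators of the form `x + Σ_a y_a · e⁻ a` with `x, y_a ∈ S`**, as a submodule of `End V`.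
[cite: JacquetShalikaAJM1981, §3, Lemma (3.4)] -/
def mulRepSubmodule {ι : Type*} [Fintype ι] (S : Submodule F (Module.End F V)) (em : ι → Module.End F V) :
    Submodule F (Module.End F V) where
  carrier := {z | ∃ x ∈ S, ∃ y : ι → Module.End F V, (∀ a, y a ∈ S) ∧ z = x + ∑ a, y a * em a}
  zero_mem' := ⟨0, S.zero_mem, 0, fun _ => S.zero_mem, by simp⟩
  add_mem' := by
    rintro z z' ⟨x, hx, y, hy, rfl⟩ ⟨x', hx', y', hy', rfl⟩
    refine ⟨x + x', S.add_mem hx hx', fun a => y a + y' a, fun a => S.add_mem (hy a) (hy' a), ?_⟩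
    simp only [add_mul, Finset.sum_add_distrib]
    abel
  smul_mem' := by
    rintro c z ⟨x, hx, y, hy, rfl⟩
    refine ⟨c • x, S.smul_mem c hx, fun a => c • y a, fun a => S.smul_mem c (hy a), ?_⟩
    simp only [smul_add, Finset.smul_sum, smul_mul_assoc]

/-- Membership in `mulRepSubmodule`. [folklore] -/
theorem mem_mulRepSubmodule_iff {ι : Type*} [Fintype ι] (S : Submodule F (Module.End F V)) (em : ι → Module.End F V)
    (z : Module.End F V) :
    z ∈ mulRepSubmodule S em ↔ ∃ x ∈ S, ∃ y : ι → Module.End F V, (∀ a, y a ∈ S) ∧ z = x + ∑ a, y a * em a :=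
  Iff.rfl

/-- **The `e⁻`-degree filtration** `degFilt B e⁻ J ≤ End V`: `degFilt 0 = B`,
`degFilt (J+1) = degFilt J + Σ_a degFilt J · e⁻ a` (the image of `Σ_{j ≤ J} U(𝔟) 𝔲̄^j`).
[cite: JacquetShalikaAJM1981, §3, Lemma (3.4)] -/
def degFilt {ι : Type*} [Fintype ι] (B : Subalgebra F (Module.End F V)) (em : ι → Module.End F V) :
    ℕ → Submodule F (Module.End F V)
  | 0 => Subalgebra.toSubmodule B
  | J + 1 => mulRepSubmodule (degFilt B em J) em

section DegFilt

variable {ι : Type*} [Fintype ι] (B : Subalgebra F (Module.End F V)) (em : ι → Module.End F V)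

/-- `degFilt 0 = B`. [folklore] -/
theorem mem_degFilt_zero_iff (x : Module.End F V) : x ∈ degFilt B em 0 ↔ x ∈ B := Iff.rfl

/-- `degFilt (J+1) = mulRepSubmodule (degFilt J) e⁻`. [folklore] -/
theorem degFilt_succ (J : ℕ) : degFilt B em (J + 1) = mulRepSubmodule (degFilt B em J) em := rfl

/-- The filtration is increasing: `degFilt J ≤ degFilt (J+1)`. [folklore] -/
theorem degFilt_le_succ (J : ℕ) : degFilt B em J ≤ degFilt B em (J + 1) := fun x hx =>
  ⟨x, hx, 0, fun _ => (degFilt B em J).zero_mem, by simp⟩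

/-- The filtration is increasing: `degFilt J ≤ degFilt J'` for `J ≤ J'`. [folklore] -/
theorem degFilt_mono {J J' : ℕ} (h : J ≤ J') : degFilt B em J ≤ degFilt B em J' := by
  induction h with
  | refl => exact le_rfl
  | step _ ih => exact ih.trans (degFilt_le_succ B em _)

/-- `1 ∈ degFilt J`. [folklore] -/
theorem one_mem_degFilt (J : ℕ) : (1 : Module.End F V) ∈ degFilt B em J :=
  degFilt_mono B em (Nat.zero_le J) (B.one_mem)

/-- **`degFilt J · b ⊆ degFilt J` for `b ∈ B`**, by (H1) `e⁻ a · b = b₁ · e⁻ a + b₂`: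
`(y e⁻ a) b = (y b₁) e⁻ a + y b₂`. [cite: JacquetShalikaAJM1981, §3, Lemma (3.4)] -/
theorem mul_mem_degFilt_of_mem (h1 : ∀ a, ∀ b ∈ B, ∃ b₁ ∈ B, ∃ b₂ ∈ B, em a * b = b₁ * em a + b₂) :
    ∀ (J : ℕ) {x : Module.End F V}, x ∈ degFilt B em J → ∀ {b : Module.End F V}, b ∈ B → x * b ∈ degFilt B em J
  | 0, x, hx, b, hb => B.mul_mem hx hb
  | J + 1, z, hz, b, hb => by
    obtain ⟨x, hx, y, hy, rfl⟩ := hz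
    choose b₁ hb₁ b₂ hb₂ hb₁₂ using fun a => h1 a b hb
    refine ⟨x * b + ∑ a, y a * b₂ a, ?_, fun a => y a * b₁ a, fun a => mul_mem_degFilt_of_mem h1 J (hy a) (hb₁ a), ?_⟩
    · exact (degFilt B em J).add_mem (mul_mem_degFilt_of_mem h1 J hx hb)
        ((degFilt B em J).sum_mem fun a _ => mul_mem_degFilt_of_mem h1 J (hy a) (hb₂ a))
    · rw [add_mul, Finset.sum_mul, add_assoc, ← Finset.sum_add_distrib]
      congr 1
      refine Finset.sum_congr rfl fun a _ => ?_
      rw [mul_assoc, hb₁₂ a, mul_add, ← mul_assoc, add_comm]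

/-- `x · e⁻ a ∈ degFilt (J+1)` for `x ∈ degFilt J`. [folklore] -/
theorem mul_em_mem_degFilt_succ [DecidableEq ι] {J : ℕ} {x : Module.End F V} (hx : x ∈ degFilt B em J) (a : ι) :
    x * em a ∈ degFilt B em (J + 1) := by
  refine ⟨0, (degFilt B em J).zero_mem, fun a' => if a' = a then x else 0, fun a' => ?_, ?_⟩
  · show (if a' = a then x else 0) ∈ degFilt B em J
    by_cases h : a' = a
    · rw [if_pos h]; exact hx
    · rw [if_neg h]; exact (degFilt B em J).zero_mem
  · rw [zero_add]
    have : ∀ a', (if a' = a then x else 0) * em a' = if a' = a then x * em a else 0 := by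
      intro a'
      by_cases h : a' = a
      · subst h; rw [if_pos rfl, if_pos rfl]
      · rw [if_neg h, if_neg h, zero_mul]
    simp_rw [this]
    rw [Finset.sum_ite_eq' Finset.univ a, if_pos (Finset.mem_univ _)]

/-- **Multiplicativity of the degree filtration**: `degFilt J · degFilt J' ⊆ degFilt (J + J')`
(given (H1)). [cite: JacquetShalikaAJM1981, §3, Lemma (3.4)] -/
theorem mul_mem_degFilt_add [DecidableEq ι] (h1 : ∀ a, ∀ b ∈ B, ∃ b₁ ∈ B, ∃ b₂ ∈ B, em a * b = b₁ * em a + b₂)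
    {J : ℕ} {x : Module.End F V} (hx : x ∈ degFilt B em J) :
    ∀ (J' : ℕ) {x' : Module.End F V}, x' ∈ degFilt B em J' → x * x' ∈ degFilt B em (J + J')
  | 0, x', hx' => by
    rw [add_zero]
    exact mul_mem_degFilt_of_mem B em h1 J hx hx'
  | J' + 1, z, hz => by
    obtain ⟨x', hx', y, hy, rfl⟩ := hz
    rw [mul_add, Finset.mul_sum, ← add_assoc]
    refine (degFilt B em (J + J' + 1)).add_mem
      (degFilt_le_succ B em _ (mul_mem_degFilt_add h1 hx J' hx')) ((degFilt B em _).sum_mem fun a _ => ?_)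
    rw [← mul_assoc]
    exact mul_em_mem_degFilt_succ B em (mul_mem_degFilt_add h1 hx J' (hy a)) a

/-- **Elements of the generated subalgebra have finite degree**: if every generator `t ∈ T` lies in
some `degFilt J`, then so does every element of `Algebra.adjoin F T` (given (H1)).
[cite: JacquetShalikaAJM1981, §3, Lemma (3.4)] -/
theorem exists_mem_degFilt_of_mem_adjoin [DecidableEq ι]
    (h1 : ∀ a, ∀ b ∈ B, ∃ b₁ ∈ B, ∃ b₂ ∈ B, em a * b = b₁ * em a + b₂)
    {T : Set (Module.End F V)} (hT : ∀ t ∈ T, ∃ J, t ∈ degFilt B em J)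
    {x : Module.End F V} (hx : x ∈ Algebra.adjoin F T) : ∃ J, x ∈ degFilt B em J := by
  induction hx using Algebra.adjoin_induction with
  | mem t ht => exact hT t ht
  | algebraMap c => exact ⟨0, B.algebraMap_mem c⟩
  | add x x' _ _ ihx ihx' =>
    obtain ⟨J, hJ⟩ := ihx
    obtain ⟨J', hJ'⟩ := ihx'
    exact ⟨max J J', (degFilt B em _).add_mem (degFilt_mono B em (le_max_left _ _) hJ)
      (degFilt_mono B em (le_max_right _ _) hJ')⟩
  | mul x x' _ _ ihx ihx' =>
    obtain ⟨J, hJ⟩ := ihx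
    obtain ⟨J', hJ'⟩ := ihx'
    exact ⟨J + J', mul_mem_degFilt_add B em h1 hJ J' hJ'⟩

end DegFilt

/-! ### 3. Link: `μ ∘ x ∈ W J` for `μ ∈ W 0`, `x` of degree `≤ J` -/

/-- **Functionals of degree `0` composed with operators of degree `J` have degree `J`**: for a family
`W` with `W 0` right `B`-stable and `W (J+1) = repSubmodule (W J) e⁻`, and `μ ∈ W 0`,
`x ∈ degFilt B e⁻ J`, the functional `μ ∘ x` lies in `W J`. [cite: JacquetShalikaAJM1981, §3, Lemma (3.4) and p. 523] -/
theorem comp_mem_of_mem_degFilt {ι : Type*} [Fintype ι] (B : Subalgebra F (Module.End F V)) (em : ι → Module.End F V)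
    (W : ℕ → Submodule F (V →ₗ[F] F))
    (hW0 : ∀ b ∈ B, ∀ μ ∈ W 0, μ.comp b ∈ W 0) (hWsucc : ∀ J, W (J + 1) = repSubmodule (W J) em)
    {μ : V →ₗ[F] F} (hμ : μ ∈ W 0) :
    ∀ (J : ℕ) {x : Module.End F V}, x ∈ degFilt B em J → μ.comp x ∈ W J
  | 0, x, hx => hW0 x hx μ hμ
  | J + 1, z, hz => by
    obtain ⟨x, hx, y, hy, rfl⟩ := hz
    rw [hWsucc J]
    refine ⟨μ.comp x, comp_mem_of_mem_degFilt B em W hW0 hWsucc hμ J hx, fun a => μ.comp (y a),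
      fun a => comp_mem_of_mem_degFilt B em W hW0 hWsucc hμ J (hy a), ?_⟩
    rw [LinearMap.comp_add]
    congr 1
    have : μ.comp (∑ a, y a * em a) = ∑ a, μ.comp (y a * em a) := by
      refine LinearMap.ext fun v => ?_
      simp only [LinearMap.comp_apply, LinearMap.sum_apply, map_sum]
    rw [this]
    refine Finset.sum_congr rfl fun a _ => ?_
    rw [Module.End.mul_eq_comp, LinearMap.comp_assoc]

/-- The successor rule of a `repSubmodule` family in the form consumed by
`mem_zero_of_mem_of_covariant`. [folklore] -/
theorem mem_succ_iff_of_eq_repSubmodule {ι : Type*} [Fintype ι] (em : ι → Module.End F V)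
    (W : ℕ → Submodule F (V →ₗ[F] F)) (hWsucc : ∀ J, W (J + 1) = repSubmodule (W J) em) (J : ℕ) (ν : V →ₗ[F] F) :
    ν ∈ W (J + 1) ↔ ∃ w ∈ W J, ∃ μ : ι → V →ₗ[F] F, (∀ a, μ a ∈ W J) ∧ ν = w + ∑ a, (μ a).comp (em a) := by
  rw [hWsucc J]
  exact Iff.rfl

end Literature.Algebra.Lie.WhittakerDescent
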